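import Summits.AtomisticToContinuum.HydrodynamicLimit.Theses.EnskogAdjointDuality
import Summits.AtomisticToContinuum.HydrodynamicLimit.Theorems.EnskogAdjointDualityAdjointEnskogTestFamilyREnskogConsistency

/-!
# Birth skeleton (BC3) for crux `AdjointEnskogTestFamilyR` (stmt-AtomisticToContinuum-11592)

Route `EnskogAdjointDuality` (route-AtomisticToContinuum-EnskogAdjointDuality, sub-problem
`HydrodynamicLimit`), crux K2R, rank 3 — the BACKWARD LINEARISED-ENSKOG TEST FAMILY, packing-guarded.
The crux is FIXED and imported BY NAME:
`Summit.AtomisticToContinuum.HydrodynamicLimit.Theses.EnskogAdjointDuality.AdjointEnskogTestFamilyR`.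

Recall the crux: on an EOS window `(0, η₁)` (`f_ex` analytic, `f_ex' > 0`, `(ηZ)' > 0`) there is
`σ₀ > 0` such that for `0 < σ < σ₀`, every classical hs-Euler solution `(ρ,u,θ)` on `[0,T)`, every
`t ∈ (0,T)` with packing `ρ_s(x)σ³ < η₁` on `[0,t]`, every smooth `χ` and constants `a, e, b`, there is
an ADMISSIBLE family `(c^N, κ^N)` (test functions `φ^N = α + β·v + γ|v|²/2 + κ^N/λ_N`) with
(i) terminal data `χ(a + b·v + e|v|²/2)`, eventually in `N` (ii) `C¹` along free flights and
(iii) approximate duality `|Dφ^N + L^N φ^N| ≤ η_N (1+|v|²)`, `η_N → 0`, (iv) `c^N(0,·) → c₀`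
uniformly, and (v) the Enskog defect of the Euler local Maxwellian tested on the family,
`Res_N = ∫∫ f_t φ^N_t − ∫∫ f_0 φ^N_0 − ∫₀ᵗ∫∫ f (Dφ^N + ½ L^N φ^N)`, tends to `0`.

## The seam: kinetic construction ∣ Euler–Enskog consistency

The two registered stubs cut the crux along the only place where the hs-Euler EQUATIONS enter:

* `stub_backwardFamily` (L→XL, HARDEST, the lever) — **pure linear kinetic theory, no Euler
  dynamics.** For ANY jointly smooth positive background `(ρ,u,θ)` on `[0,T) × 𝕋³` inside the EOS
  window (the three `Torus.IsSmoothSpaceTimeOn` fields and the two positivity fields of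
  `IsHardSphereEulerSolution`, but NOT its `mass`/`momentum`/`energy` equations) there is an
  admissible family with (i), (ii)+(iii) eventually, (iv): the backward problem
  `∂_sφ + v·∇φ + L^N_s φ ≈ 0` from hydrodynamic terminal data — exact backward solution
  (dissipative in reversed time) split as `P_sφ + κ/λ_N`, i.e. the Hilbert expansion of the TEST
  function; P-part = adjoint linearised hs-Euler-type system (symmetrizable since `(ηZ)' > 0`,
  whatever the background does), (1−P)-part = corrector; the whole difficulty is the uniform-in-`λ_N`
  weighted (`⟨v⟩²`) sup/Lipschitz control incl. the `1/λ_N` terminal layer (crux's declared risk;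
  refuter 2026-08-15: no finite Hilbert truncation meets (iii) — cubic terms — so the exact solution
  is needed; favourable: Markov structure of the test-side operator at large `|v|`).
* `stub_enskogConsistency` (M→L) — **the Euler local Maxwellian is a weak approximate solution of
  the Enskog equation on every approximately-dual admissible family.** For every classical hs-Euler
  solution in the window and EVERY admissible family satisfying (ii)∧(iii) eventually, (v) holds.
  Mechanism: for `N` large, differentiating `s ↦ ∫∫ f_s φ^N_s` along free flights (torus translation
  invariance; dominated bounds from (iii) + the `(1+|v|²)²` growth of `L^N φ`) gives the EXACT
  identity `Res_N = ∫₀ᵗ [⟨(∂_s + v·∇)f, φ^N⟩ − ½⟨f, L^N φ^N⟩] ds`; then (a) hydrodynamic part: the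
  hs-Euler moments give `∫ p_ex (div β^N + u·∇γ^N)`, `p_ex = ρθ(Z−1)`, while the collisional
  transfer gives `½⟨f, L^N ψ^N⟩ → (2π/3)σ³ ∫ Yρ²θ (div β^N + u·∇γ^N)` — equal since
  `(2π/3)ηY = Z − 1`, `λ_N ε_N → σ³` (finite differences of the merely Lipschitz `β^N, γ^N` are moved
  onto the smooth background); (b) corrector part: `⟨(∂+v·∇)f, κ^N⟩/λ_N = O(1/λ_N)` and
  `½⟨f, L^N κ^N⟩/λ_N → 0` by local detailed balance `M M_* = M'M'_*` (zeroth order vanishes, Enskog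
  shifts cost `O(ε_N)` against the uniform weighted-Lipschitz constant). Constants (`½`, ordered
  pairs, `λ_N = Nε_N²`, `sphereMeasure` of mass `4π`, Maxwellian variance `θ`, `Y = (3/2π) f_ex'`)
  were re-derived independently by the planner (K2R_repair_memo.md) and the crux-attack refuter
  (EVIDENCE.md, 2026-08-15): no constant slip.

Composition `AdjointEnskogTestFamilyR_of (hA : Registered.stub_backwardFamily) (hB : Registered.stub_enskogConsistency) :
AdjointEnskogTestFamilyR` (PROVED, no sorry; the stub statements are the named Props `BackwardFamily`,
`EnskogConsistency`, aliased under `Registered.stub_*` so the skeleton audit keys the hypotheses by stub name): `σ₀ := min σ₀(A) σ₀(B)`; the family of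
`stub_backwardFamily` at the hs-Euler background (its smoothness/positivity fields), then
`stub_enskogConsistency` applied to THAT family and its approximate-duality package gives (v).

Disproof.lean: none on this crux at registration (`ledger crux ls` empty). Negative knowledge honoured:
the refuted predecessor `AdjointEnskogTestFamily` (stmt-9168; junk EOS branch at packing 1000, and
`N = 0` where `λ_0 = 0`) — both stubs keep the packing guard + EOS window and ask (ii)–(iii) only
eventually in `N`, exactly as the repaired crux.
-/

namespace Summit.AtomisticToContinuum.HydrodynamicLimit.Cruxes.AdjointEnskogTestFamilyR.Birth

open scoped BigOperators Topology Manifold Classical MeasureTheory ProbabilityTheory Matrix InnerProductSpace ComplexConjugate ContinuousMap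
open Filter Set Function TopologicalSpace MeasureTheory
open Summit.AtomisticToContinuum.HydrodynamicLimit.Theses.EnskogAdjointDuality (AdjointEnskogTestFamilyR)

/-! ### The two stub statements, as named propositions -/

/-- **Stub statement A — the kinetic construction (no Euler dynamics).** For every EOS window and every jointly
smooth positive background `(ρ,u,θ)` on `[0,T) × 𝕋³` (the smoothness and positivity fields of
`IsHardSphereEulerSolution`, not its conservation laws), every `t ∈ (0,T)` with packing `< η₁` on `[0,t]`, smooth
`χ` and constants `a e b`: an admissible backward test family with hydrodynamic terminal data (i), eventually `C¹`
along free flights (ii) and approximately dual (iii) (`|Dφ + L^N φ| ≤ η_N(1+|v|²)`, `η_N → 0`), whose hydrodynamic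
coefficients at `s = 0` converge uniformly to a continuous limit (iv). The `let`-block is verbatim the crux's. -/
def BackwardFamily : Prop :=
  ∀ η₁ : ℝ, 0 < η₁ → AnalyticOnNhd ℝ Literature.MathematicalPhysics.KineticTheory.hsExcessFreeEnergy (Set.Ioo 0 η₁) → (∀ η ∈ Set.Ioo 0 η₁, 0 < deriv Literature.MathematicalPhysics.KineticTheory.hsExcessFreeEnergy η) → (∀ η ∈ Set.Ioo 0 η₁, 0 < deriv (fun x : ℝ => x * Literature.MathematicalPhysics.KineticTheory.hsCompressibility x) η) → ∃ σ₀ : ℝ, 0 < σ₀ ∧ ∀ σ : ℝ, 0 < σ → σ < σ₀ → ∀ (T : ℝ) (ρ θ : ℝ → UnitAddTorus (Fin 3) → ℝ) (u : ℝ → UnitAddTorus (Fin 3) → EuclideanSpace ℝ (Fin 3)), Literature.Analysis.FunctionSpaces.Torus.IsSmoothSpaceTimeOn (Set.Ico 0 T) ρ → Literature.Analysis.FunctionSpaces.Torus.IsSmoothSpaceTimeOn (Set.Ico 0 T) u → Literature.Analysis.FunctionSpaces.Torus.IsSmoothSpaceTimeOn (Set.Ico 0 T) θ → (∀ s ∈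 Set.Ico 0 T, ∀ x, 0 < ρ s x) → (∀ s ∈ Set.Ico 0 T, ∀ x, 0 < θ s x) → ∀ t ∈ Set.Ioo 0 T, (∀ s ∈ Set.Icc 0 t, ∀ x, ρ s x * σ ^ 3 < η₁) → ∀ χ : UnitAddTorus (Fin 3) → ℝ, Literature.Analysis.FunctionSpaces.Torus.IsSmooth χ → ∀ (a e : ℝ) (b : EuclideanSpace ℝ (Fin 3)), ∃ (c : ℕ → ℝ → UnitAddTorus (Fin 3) → ℝ × EuclideanSpace ℝ (Fin 3) × ℝ) (κ : ℕ → ℝ → UnitAddTorus (Fin 3) → EuclideanSpace ℝ (Fin 3) → ℝ), (∀ N, Continuous (Function.uncurry (c N))) ∧ (∀ N, Continuous (fun p : ℝ × UnitAddTorus (Fin 3) × EuclideanSpace ℝ (Fin 3) => κ N p.1 p.2.1 p.2.2)) ∧ (∃ C : ℝ, ∀ N s x x' v v', ‖c N s x‖ ≤ C ∧ dist (c N s x) (c N s x') ≤ C * dist x x' ∧ |κ N s x v| ≤ C * (1 + ‖v‖ ^ 2) ∧ |κ N s x v - κ N s x' v'| ≤ C * (1 + ‖v‖ ^ 2 + ‖v'‖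 ^ 2) * (dist x x' + ‖v - v'‖)) ∧ (let G := Literature.Analysis.FluidPDE.Torus.geometry (Fin 3); let ε := fun N : ℕ => Literature.MathematicalPhysics.KineticTheory.hsDiameter σ N; let lam := fun N : ℕ => (N : ℝ) * ε N ^ 2; let f := fun (s : ℝ) (x : UnitAddTorus (Fin 3)) (v : EuclideanSpace ℝ (Fin 3)) => ρ s x * Literature.Analysis.FluidPDE.localMaxwellian 1 (θ s x) (u s x) v; let Y := fun η : ℝ => 3 / (2 * Real.pi) * deriv Literature.MathematicalPhysics.KineticTheory.hsExcessFreeEnergy η; let φ := fun (N : ℕ) (s : ℝ) (x : UnitAddTorus (Fin 3)) (v : EuclideanSpace ℝ (Fin 3)) => (c N s x).1 + inner ℝ (c N s x).2.1 v + (c N s x).2.2 * ‖v‖ ^ 2 / 2 + (lam N)⁻¹ * κ N s x v; let L := fun (N : ℕ) (s : ℝ) (x : UnitAddTorus (Fin 3)) (v : EuclideanSpace ℝ (Fin 3)) => lam N * ∫ ω : Metric.sphere (0 : EuclideanSpace ℝ (Fin 3)) 1, (let y := G.translate x (ε N • (ω : EuclideanSpace ℝ (Fin 3))); ∫ w : EuclideanSpace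 ℝ (Fin 3), max (inner ℝ (v - w) ω) 0 * Y (σ ^ 3 * ρ s (G.translate x ((ε N / 2) • (ω : EuclideanSpace ℝ (Fin 3))))) * f s y w * (φ N s x (v - inner ℝ (v - w) ω • (ω : EuclideanSpace ℝ (Fin 3))) + φ N s y (w + inner ℝ (v - w) ω • (ω : EuclideanSpace ℝ (Fin 3))) - φ N s x v - φ N s y w)) ∂Literature.MathematicalPhysics.KineticTheory.sphereMeasure; (∀ N x v, φ N t x v = χ x * (a + inner ℝ b v + e * ‖v‖ ^ 2 / 2)) ∧ (∃ η : ℕ → ℝ, Filter.Tendsto η Filter.atTop (nhds 0) ∧ ∀ᶠ N in Filter.atTop, (∀ x v, ContDiffOn ℝ 1 (fun r => φ N r (G.translate x (r • v)) v) (Set.Icc 0 t)) ∧ (∀ s ∈ Set.Icc 0 t, ∀ x v, |derivWithin (fun r => φ N r (G.translate x ((r - s) • v)) v) (Set.Icc 0 t) s + L N s x v| ≤ η N * (1 + ‖v‖ ^ 2))) ∧ (∃ c₀ : UnitAddTorus (Fin 3) → ℝ × EuclideanSpace ℝ (Fin 3) × ℝ, Continuous c₀ ∧ ∀ δ : ℝ,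 0 < δ → ∀ᶠ N in Filter.atTop, ∀ x, dist (c N 0 x) (c₀ x) ≤ δ))

/-- **Stub statement B — Euler–Enskog consistency of the local Maxwellian.** Along every packing-guarded classical
hs-Euler solution (in an EOS window, `σ < σ₀`) and for EVERY admissible family `(c, κ)` that is eventually `C¹`
along free flights and approximately dual, the Enskog defect of `f = ρ M_{1,θ,u}` tested on the family tends to `0`
(crux clause (v)): hs-Euler pressure `ρθZ(ρσ³)` ⇔ Enskog collisional transfer at contact value `Y = (3/2π)f_ex'`,
`(2π/3)ηY = Z − 1`, `λ_N ε_N → σ³`; local detailed balance kills the corrector's `O(1)` term. The `let`-block is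
verbatim the crux's. -/
def EnskogConsistency : Prop :=
  ∀ η₁ : ℝ, 0 < η₁ → AnalyticOnNhd ℝ Literature.MathematicalPhysics.KineticTheory.hsExcessFreeEnergy (Set.Ioo 0 η₁) → (∀ η ∈ Set.Ioo 0 η₁, 0 < deriv Literature.MathematicalPhysics.KineticTheory.hsExcessFreeEnergy η) → (∀ η ∈ Set.Ioo 0 η₁, 0 < deriv (fun x : ℝ => x * Literature.MathematicalPhysics.KineticTheory.hsCompressibility x) η) → ∃ σ₀ : ℝ, 0 < σ₀ ∧ ∀ σ : ℝ, 0 < σ → σ < σ₀ → ∀ (T : ℝ) (ρ θ : ℝ → UnitAddTorus (Fin 3) → ℝ) (u : ℝ → UnitAddTorus (Fin 3) → EuclideanSpace ℝ (Fin 3)), Literature.MathematicalPhysics.KineticTheory.IsHardSphereEulerSolution σ T ρ u θ → ∀ t ∈ Set.Ioo 0 T, (∀ s ∈ Set.Icc 0 t, ∀ x, ρ s x * σ ^ 3 < η₁) → ∀ (c : ℕ → ℝ → UnitAddTorus (Fin 3) → ℝ × EuclideanSpace ℝ (Fin 3) × ℝ) (κ : ℕ → ℝ → UnitAddTorus (Fin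 3) → EuclideanSpace ℝ (Fin 3) → ℝ), (∀ N, Continuous (Function.uncurry (c N))) → (∀ N, Continuous (fun p : ℝ × UnitAddTorus (Fin 3) × EuclideanSpace ℝ (Fin 3) => κ N p.1 p.2.1 p.2.2)) → (∃ C : ℝ, ∀ N s x x' v v', ‖c N s x‖ ≤ C ∧ dist (c N s x) (c N s x') ≤ C * dist x x' ∧ |κ N s x v| ≤ C * (1 + ‖v‖ ^ 2) ∧ |κ N s x v - κ N s x' v'| ≤ C * (1 + ‖v‖ ^ 2 + ‖v'‖ ^ 2) * (dist x x' + ‖v - v'‖)) → (let G := Literature.Analysis.FluidPDE.Torus.geometry (Fin 3); let ε := fun N : ℕ => Literature.MathematicalPhysics.KineticTheory.hsDiameter σ N; let lam := fun N : ℕ => (N : ℝ) * ε N ^ 2; let f := fun (s : ℝ) (x : UnitAddTorus (Fin 3)) (v : EuclideanSpace ℝ (Fin 3)) => ρ s x * Literature.Analysis.FluidPDE.localMaxwellian 1 (θ s x) (u s x) v; let Y := fun η : ℝ => 3 / (2 * Real.pi) * deriv Literature.MathematicalPhysics.KineticTheory.hsExcessFreeEnergy η; let φ := fun (N : ℕ)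 (s : ℝ) (x : UnitAddTorus (Fin 3)) (v : EuclideanSpace ℝ (Fin 3)) => (c N s x).1 + inner ℝ (c N s x).2.1 v + (c N s x).2.2 * ‖v‖ ^ 2 / 2 + (lam N)⁻¹ * κ N s x v; let L := fun (N : ℕ) (s : ℝ) (x : UnitAddTorus (Fin 3)) (v : EuclideanSpace ℝ (Fin 3)) => lam N * ∫ ω : Metric.sphere (0 : EuclideanSpace ℝ (Fin 3)) 1, (let y := G.translate x (ε N • (ω : EuclideanSpace ℝ (Fin 3))); ∫ w : EuclideanSpace ℝ (Fin 3), max (inner ℝ (v - w) ω) 0 * Y (σ ^ 3 * ρ s (G.translate x ((ε N / 2) • (ω : EuclideanSpace ℝ (Fin 3))))) * f s y w * (φ N s x (v - inner ℝ (v - w) ω • (ω : EuclideanSpace ℝ (Fin 3))) + φ N s y (w + inner ℝ (v - w) ω • (ω : EuclideanSpace ℝ (Fin 3))) - φ N s x v - φ N s y w)) ∂Literature.MathematicalPhysics.KineticTheory.sphereMeasure; (∃ η : ℕ → ℝ, Filter.Tendsto η Filter.atTop (nhds 0) ∧ ∀ᶠ N in Filter.atTop, (∀ x v, ContDiffOn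 ℝ 1 (fun r => φ N r (G.translate x (r • v)) v) (Set.Icc 0 t)) ∧ (∀ s ∈ Set.Icc 0 t, ∀ x v, |derivWithin (fun r => φ N r (G.translate x ((r - s) • v)) v) (Set.Icc 0 t) s + L N s x v| ≤ η N * (1 + ‖v‖ ^ 2))) → Filter.Tendsto (fun N : ℕ => (∫ x : UnitAddTorus (Fin 3), ∫ v : EuclideanSpace ℝ (Fin 3), f t x v * φ N t x v) - (∫ x : UnitAddTorus (Fin 3), ∫ v : EuclideanSpace ℝ (Fin 3), f 0 x v * φ N 0 x v) - ∫ s in Set.Icc 0 t, ∫ x : UnitAddTorus (Fin 3), ∫ v : EuclideanSpace ℝ (Fin 3), f s x v * (derivWithin (fun r => φ N r (G.translate x ((r - s) • v)) v) (Set.Icc 0 t) s + (1 / 2 : ℝ) * L N s x v)) Filter.atTop (nhds 0))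

/-! ### Reshaped line, v4 (c3 lead, after wave 2): the whole B side has LANDED.
Clause (v) `EnskogConsistency` is the tree theorem
`Summit.AtomisticToContinuum.HydrodynamicLimit.Theorems.EnskogAdjointDuality.stub_enskogConsistency`
(Theorems/EnskogAdjointDualityAdjointEnskogTestFamilyREnskogConsistency.lean), composed from the landed G1 `stub_defectSplit`,
G2 `stub_fluidMoments`, G3a `stub_transferReduction`, G3b `stub_transferBound`, G4 `stub_correctorEstimate`,
G5 `stub_consistencyAssembly`, themselves on the generic B1–B4 (`stub_telescopeProduct`, `stub_maxwellianCharDeriv`,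
`stub_pairGaussian`, `stub_spatialTransfer`, `stub_correctorBalance`) — 30 files under Theorems/. The ONLY open
obligation of the line is stub A `stub_backwardFamily` (the kinetic construction). -/

/-! ### Registered stubs (the open obligations of the line; `sorry` only here) -/

/-- STUB A (L→XL; HARDEST — the lever: stiff backward test-side linearised Enskog flow, uniform `⟨v⟩²` control;
held by the lead). What it needs (see NOTES.md Census of the lead): (A1) for each `N` a mild backward solution of
`∂_sφ + v·∇φ + L^N_sφ = 0` on `[0,t]` from the hydrodynamic terminal data, continuous, `C¹` along free flights,
of quadratic velocity growth; (A2) UNIFORM-in-`λ_N` `⟨v⟩²`-weighted sup and weighted-Lipschitz bounds on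
`λ_N (1 − P_{s,x})φ^N` (the borderline weight `k = 2`; not in print); (A3) uniform convergence of `P φ^N(0,·)`
(linear symmetric-hyperbolic theory on `𝕋³` for the adjoint linearised hs-Euler system). -/
theorem stub_backwardFamily : BackwardFamily := by
  sorry

/-- Clause (v), PROVED in the tree (no `sorry`): the skeleton's `EnskogConsistency` is literally the type of
`Theorems.EnskogAdjointDuality.stub_enskogConsistency`. -/
theorem enskogConsistency_holds : EnskogConsistency :=
  Summit.AtomisticToContinuum.HydrodynamicLimit.Theorems.EnskogAdjointDuality.stub_enskogConsistency

/-! ### Name-keyed aliases of the stub statements (the hypotheses of the composition) -/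
namespace Registered

/-- Alias of `BackwardFamily` keyed by the registered stub name. -/
abbrev stub_backwardFamily : Prop := BackwardFamily

end Registered

/-! ### Composition (PROVED): the stub implies the crux BY NAME -/

/-- **The line concludes the crux BY NAME** from the single remaining registered stub (no `sorry` outside it):
`σ₀ := min σ₀(A) σ₀(B)`; the family of A at the hs-Euler background's smoothness/positivity fields carries
(i)–(iv); the PROVED `EnskogConsistency` applied to THAT family and its approximate-duality package gives (v). -/
theorem AdjointEnskogTestFamilyR_of (hA : Registered.stub_backwardFamily) : AdjointEnskogTestFamilyR := by
  have hB : EnskogConsistency := enskogConsistency_holds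
  intro η₁ hη₁ han hY hZ
  obtain ⟨σ₁, hσ₁, hA'⟩ := hA η₁ hη₁ han hY hZ
  obtain ⟨σ₂, hσ₂, hB'⟩ := hB η₁ hη₁ han hY hZ
  refine ⟨min σ₁ σ₂, lt_min hσ₁ hσ₂, ?_⟩
  intro σ hσ hσlt T ρ θ u hEul t ht hguard χ hχ a e b
  obtain ⟨c, κ, hc, hκ, hadm, hterm, hdual, hconv⟩ :=
    hA' σ hσ (lt_of_lt_of_le hσlt (min_le_left σ₁ σ₂)) T ρ θ u hEul.smooth_density
      hEul.smooth_velocity hEul.smooth_temperature hEul.density_pos hEul.temperature_pos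
      t ht hguard χ hχ a e b
  have hres := hB' σ hσ (lt_of_lt_of_le hσlt (min_le_right σ₁ σ₂)) T ρ θ u hEul t ht hguard
    c κ hc hκ hadm hdual
  exact ⟨c, κ, hc, hκ, hadm, hterm, hdual, hconv, hres⟩

/-- Wiring check: the registered stub feeds `AdjointEnskogTestFamilyR_of` as stated. -/
example : AdjointEnskogTestFamilyR :=
  AdjointEnskogTestFamilyR_of stub_backwardFamily

end Summit.AtomisticToContinuum.HydrodynamicLimit.Cruxes.AdjointEnskogTestFamilyR.Birth
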